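import Mathlib.Analysis.Calculus.ContDiff.Bounds
import Mathlib.Analysis.Calculus.IteratedDeriv.Lemmas
import HarnessLib

/-!
# Faà di Bruno bound for one-variable compositions with a locally smooth inner function

Topic `Literature/Analysis/Calculus`; the one-variable form of Mathlib's `norm_iteratedFDerivWithin_comp_le`
(`‖(g ∘ f)^{(n)}(x)‖ ≤ n! C Dⁿ` when `‖g^{(i)}(f x)‖ ≤ C` and `‖f^{(i)}(x)‖ ≤ Dⁱ`), for an inner function that
is smooth only on an open set `U ∋ x` — the situation of an ANGLE along a line (`t ↦ arg(a + tb)` is smooth off the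
cut only), composed with a smooth angular profile: the sector cutoffs `ζ̃_{h,ω}(θ(k⃗))` of
Benfatto–Giuliani–Mastropietro 2006 along lines in momentum space.

* **`norm_iteratedDeriv_comp_le_of_contDiffOn`** — `‖iteratedDeriv n (g ∘ f) x‖ ≤ n! C Dⁿ`.
* `norm_iteratedDeriv_comp_le_of_contDiffOn_of_le` — the same with `i! ≤ n!` absorbed for all orders `i ≤ n` at once.

Everything is proved; no definitions, no named facts. [folklore]

## Sources

Routine calculus ("folklore"); Mathlib `norm_iteratedFDerivWithin_comp_le`.  Used for G. Benfatto, A. Giuliani,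
V. Mastropietro, Ann. Henri Poincaré 7 (2006) 809–898, §2.5 Lemma 2.2 / §2.7 (`BenfattoGiulianiMastropietro2006`).
-/

noncomputable section

open Set
open scoped Nat

namespace Literature.Analysis.Calculus

variable {E : Type*} [NormedAddCommGroup E] [NormedSpace ℝ E]

/-- **Faà di Bruno bound, inner function smooth on an open set**: if `g : ℝ → E` is `Cⁿ` with
`‖g^{(i)}(f x)‖ ≤ C` for `i ≤ n`, and `f : ℝ → ℝ` is `Cⁿ` on an open `U ∋ x` with `‖f^{(i)}(x)‖ ≤ Dⁱ` for
`1 ≤ i ≤ n`, then `‖(g ∘ f)^{(n)}(x)‖ ≤ n! C Dⁿ`. [folklore] -/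
theorem norm_iteratedDeriv_comp_le_of_contDiffOn {g : ℝ → E} {f : ℝ → ℝ} {U : Set ℝ} (hU : IsOpen U) {x : ℝ}
    (hx : x ∈ U) {n : ℕ} (hg : ContDiff ℝ n g) (hf : ContDiffOn ℝ n f U) {C D : ℝ}
    (hC : ∀ i, i ≤ n → ‖iteratedDeriv i g (f x)‖ ≤ C) (hD : ∀ i, 1 ≤ i → i ≤ n → ‖iteratedDeriv i f x‖ ≤ D ^ i) :
    ‖iteratedDeriv n (g ∘ f) x‖ ≤ n ! * C * D ^ n := by
  have hC' : ∀ i, i ≤ n → ‖iteratedFDerivWithin ℝ i g univ (f x)‖ ≤ C := fun i hi => by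
    rw [iteratedFDerivWithin_univ, norm_iteratedFDeriv_eq_norm_iteratedDeriv]; exact hC i hi
  have hD' : ∀ i, 1 ≤ i → i ≤ n → ‖iteratedFDerivWithin ℝ i f U x‖ ≤ D ^ i := fun i hi1 hi => by
    rw [iteratedFDerivWithin_of_isOpen i hU hx, norm_iteratedFDeriv_eq_norm_iteratedDeriv]; exact hD i hi1 hi
  have h := norm_iteratedFDerivWithin_comp_le (𝕜 := ℝ) (N := (n : ℕ∞)) hg.contDiffOn hf (by exact_mod_cast le_rfl)
    uniqueDiffOn_univ hU.uniqueDiffOn (mapsTo_univ _ _) hx hC' hD'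
  rwa [iteratedFDerivWithin_of_isOpen n hU hx, norm_iteratedFDeriv_eq_norm_iteratedDeriv] at h

/-- The same for all orders `i ≤ n` at once, with `i! ≤ n!`: `‖(g ∘ f)^{(i)}(x)‖ ≤ n! C Dⁱ` (for `C ≥ 0`, `D ≥ 0`).
[folklore] -/
theorem norm_iteratedDeriv_comp_le_of_contDiffOn_of_le {g : ℝ → E} {f : ℝ → ℝ} {U : Set ℝ} (hU : IsOpen U)
    {x : ℝ} (hx : x ∈ U) {n : ℕ} (hg : ContDiff ℝ n g) (hf : ContDiffOn ℝ n f U) {C D : ℝ} (hC0 : 0 ≤ C)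
    (hD0 : 0 ≤ D) (hC : ∀ i, i ≤ n → ∀ y, ‖iteratedDeriv i g y‖ ≤ C)
    (hD : ∀ i, 1 ≤ i → i ≤ n → ‖iteratedDeriv i f x‖ ≤ D ^ i) {i : ℕ} (hi : i ≤ n) :
    ‖iteratedDeriv i (g ∘ f) x‖ ≤ n ! * C * D ^ i := by
  have h := norm_iteratedDeriv_comp_le_of_contDiffOn hU hx (hg.of_le (by exact_mod_cast hi))
    (hf.of_le (by exact_mod_cast hi)) (fun j hj => hC j (hj.trans hi) (f x)) (fun j hj1 hj => hD j hj1 (hj.trans hi))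
  refine h.trans ?_
  have hfac : ((i ! : ℕ) : ℝ) ≤ (n ! : ℕ) := by exact_mod_cast Nat.factorial_le hi
  gcongr

end Literature.Analysis.Calculus
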